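import Literature.NumberTheory.Automorphic.HeckeGelfandTrick
import Mathlib.RingTheory.SimpleModule.Isotypic
import Mathlib.LinearAlgebra.FiniteDimensional.Basic
import HarnessLib

/-!
# Hecke operators act by the scalars of the type on the `K`-fixed vectors of an isotypic representation

Topic `NumberTheory/Automorphic`; namespace `Literature.NumberTheory.Automorphic`.  THEOREMS ONLY (no definition, no
named fact, no instance), over the tree's concrete Hecke operators ★ `heckeOperator ρ K g = ∑_{yK ⊆ KgK} ρ(y)`
(`HeckeAlgebra`; the orbit-sum form ★ `heckeOperator_apply_eq_sum_out` of `HeckeGelfandTrick`) and `K`-fixed vectors ★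
`Representation.fixedPoints`.

Let `k` be a field, `K ≤ G` groups, `τ : G → GL(T)` a representation and `π : G → GL(W)` a representation whose
`k[G]`-module is its own `τ`-isotypic component (Mathlib `isotypicComponent k[G] π.asModule τ.asModule = ⊤`, i.e. `π` is a
sum of copies of the simple `τ` — here `τ` irreducible).

* `heckeOperator_apply_eq_smul_of_isotypic` — **if `[KgK]` acts on `T^K` by the scalar `c`, it acts on `W^K` by `c`.**
  (Transport along a `k[G]`-isomorphism `π ≅ ⊕_ι τ` (Mathlib `IsIsotypicOfType.linearEquiv_finsupp`): the `K`-fixed vectors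
  and the coset sums are computed coordinatewise.)
* `exists_heckeOperator_apply_eq_smul_of_finrank_le_one` — if `dim T^K ≤ 1` then every `[KgK]` with `KgK/K` finite acts on
  `T^K` by a scalar; with the previous item, **the local Hecke operators at a place where the irreducible local type is
  spherical act on the `K`-fixed vectors of ANY representation of that local type by the type's scalars** — the unramified
  half of Flath's theorem read without the restricted tensor product (Flath 1979, §2 Example 2 and Thm. 2; Cartier 1979,
  §IV.1 Cor. 4.1; Bump 1997, Thm. 3.4.4 ∕ Thm. 4.6.2).

## References
* D. Flath, *Decomposition of representations into tensor products*, PSPM 33.1 (1979), §2 Example 2, Thm. 2.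
* P. Cartier, *Representations of 𝔭-adic groups: a survey*, PSPM 33.1 (1979), §IV.1, Cor. 4.1.
* D. Bump, *Automorphic Forms and Representations* (1997), Thm. 3.4.4, Prop. 4.2.3, Thm. 4.6.2.
-/

set_option autoImplicit false

noncomputable section

open MulAction
open scoped MonoidAlgebra

namespace Literature.NumberTheory.Automorphic

universe u

variable {k : Type*} [Field k] {G : Type*} [Group G] (K : Subgroup G)
variable {T : Type u} {W : Type u} [AddCommGroup T] [Module k T] [AddCommGroup W] [Module k W]
variable (τ : Representation k G T) (π : Representation k G W)

/-- The `k[G]`-linear isomorphism `π ≅ ⊕_ι τ` of a `τ`-isotypic `π` (Mathlib `IsIsotypicOfType.linearEquiv_finsupp` behind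
`isotypicComponent … = ⊤`). [cite: Bump1997, Prop. 3.4.1] -/
theorem exists_linearEquiv_finsupp_of_isotypicComponent_eq_top [τ.IsIrreducible]
    (hπ : isotypicComponent k[G] π.asModule τ.asModule = ⊤) :
    ∃ ι : Type u, Nonempty (π.asModule ≃ₗ[k[G]] ι →₀ τ.asModule) := by
  haveI : IsSemisimpleModule k[G] (⊤ : Submodule k[G] π.asModule) := hπ ▸ inferInstance
  haveI : IsSemisimpleModule k[G] π.asModule := IsSemisimpleModule.congr Submodule.topEquiv.symm
  exact (IsIsotypicOfType.of_isotypicComponent_eq_top hπ).linearEquiv_finsupp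

/-- Under a `k[G]`-linear map `e : π → ⊕_ι τ` the group acts coordinatewise (bookkeeping through `asModuleEquiv`).
[folklore] -/
private theorem asModuleEquiv_linearEquiv_apply {ι : Type*} (e : π.asModule ≃ₗ[k[G]] ι →₀ τ.asModule) (g : G) (w : W)
    (i : ι) : τ.asModuleEquiv (e (π.asModuleEquiv.symm (π g w)) i) = τ g (τ.asModuleEquiv (e (π.asModuleEquiv.symm w) i)) := by
  rw [Representation.asModuleEquiv_symm_map_rho, map_smul, Finsupp.smul_apply, Representation.asModuleEquiv_map_smul,
    MonoidAlgebra.of_apply, Representation.asAlgebraHom_single, one_smul]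

/-- A `τ`-isotypic `π` is `k`-linearly isomorphic to `⊕_ι T` compatibly with the actions (honest carriers `W`, `T`).
[cite: Bump1997, Prop. 3.4.1] -/
theorem exists_linearEquiv_finsupp_apply_eq [τ.IsIrreducible]
    (hπ : isotypicComponent k[G] π.asModule τ.asModule = ⊤) :
    ∃ (ι : Type u) (E : W ≃ₗ[k] (ι →₀ T)), ∀ (g : G) (w : W) (i : ι), E (π g w) i = τ g (E w i) := by
  obtain ⟨ι, ⟨e⟩⟩ := exists_linearEquiv_finsupp_of_isotypicComponent_eq_top τ π hπ
  refine ⟨ι, π.asModuleEquiv.symm ≪≫ₗ e.restrictScalars k ≪≫ₗ Finsupp.mapRange.linearEquiv τ.asModuleEquiv,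
    fun g w i => ?_⟩
  simp only [LinearEquiv.trans_apply, LinearEquiv.restrictScalars_apply, Finsupp.mapRange.linearEquiv_apply,
    Finsupp.mapRange_apply]
  exact asModuleEquiv_linearEquiv_apply τ π e g w i

/-- **A Hecke operator acting by a scalar on the `K`-fixed vectors of `τ` acts by the same scalar on the `K`-fixed vectors
of every `τ`-isotypic representation.**  If `[KgK] t = c • t` for all `t ∈ T^K` (with `KgK/K` finite) and the
`k[G]`-module of `π` is its own `τ`-isotypic component, then `[KgK] w = c • w` for all `w ∈ W^K`. (Flath 1979, §2 Example 2
∕ Thm. 2: the unramified Hecke algebra acts through the spherical line of the local factor.) [cite: FlathCorvallis1979, §2 Example 2] -/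
theorem heckeOperator_apply_eq_smul_of_isotypic [τ.IsIrreducible]
    (hπ : isotypicComponent k[G] π.asModule τ.asModule = ⊤) (g : G) (hfin : (orbit K (g : G ⧸ K)).Finite) (c : k)
    (hτ : ∀ t ∈ τ.fixedPoints K, heckeOperator τ K g t = c • t) (w : W) (hw : w ∈ π.fixedPoints K) :
    heckeOperator π K g w = c • w := by
  classical
  obtain ⟨ι, E, hE⟩ := exists_linearEquiv_finsupp_apply_eq τ π hπ
  -- the coordinates of `E w` are `K`-fixed
  have hcoord : ∀ i, E w i ∈ τ.fixedPoints K := fun i => by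
    rw [Representation.mem_fixedPoints]
    intro κ hκ
    rw [← hE κ w i, (π.mem_fixedPoints K w).1 hw κ hκ]
  -- apply `E` and compute coordinatewise
  apply E.injective
  apply Finsupp.ext
  intro i
  rw [map_smul, Finsupp.smul_apply, heckeOperator_apply_eq_sum_out π K g hfin hw, map_sum, Finsupp.finsetSum_apply]
  simp_rw [hE]
  rw [← heckeOperator_apply_eq_sum_out τ K g hfin (hcoord i), hτ _ (hcoord i)]

/-- **An endomorphism preserving a line acts on it by a scalar**: if `dim T^K ≤ 1`, every Hecke operator `[KgK]` with
`KgK/K` finite acts on `T^K` by a scalar. (Cartier 1979, §IV.1; Bump 1997, Thm. 4.6.2 — the spherical line.)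
[cite: Bump1997, Thm. 4.6.2] -/
theorem exists_heckeOperator_apply_eq_smul_of_finrank_le_one (g : G) (hfin : (orbit K (g : G ⧸ K)).Finite)
    [FiniteDimensional k (τ.fixedPoints K)] (h1 : Module.finrank k (τ.fixedPoints K) ≤ 1) :
    ∃ c : k, ∀ t ∈ τ.fixedPoints K, heckeOperator τ K g t = c • t := by
  -- `[KgK]` restricts to an endomorphism of the (≤ 1)-dimensional space `T^K`
  by_cases h0 : Module.finrank k (τ.fixedPoints K) = 0
  · refine ⟨0, fun t ht => ?_⟩
    have : (⟨t, ht⟩ : τ.fixedPoints K) = 0 := by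
      haveI : Subsingleton (τ.fixedPoints K) := Module.finrank_zero_iff.1 h0
      exact Subsingleton.elim _ _
    rw [zero_smul, show t = 0 from congrArg Subtype.val this, map_zero]
  · have h1' : Module.finrank k (τ.fixedPoints K) = 1 := by omega
    obtain ⟨t₀, ht₀⟩ := finrank_eq_one_iff'.1 h1'
    -- `[KgK] t₀ ∈ T^K = k t₀`
    have hmem : heckeOperator τ K g (t₀ : T) ∈ τ.fixedPoints K :=
      heckeOperator_apply_mem_fixedPoints τ K g t₀.2 hfin
    obtain ⟨c, hc⟩ := ht₀.2 ⟨_, hmem⟩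
    refine ⟨c, fun t ht => ?_⟩
    obtain ⟨a, ha⟩ := ht₀.2 ⟨t, ht⟩
    have hta : t = a • (t₀ : T) := by simpa using congrArg Subtype.val ha.symm
    have hc' : heckeOperator τ K g (t₀ : T) = c • (t₀ : T) := by simpa using congrArg Subtype.val hc.symm
    rw [hta, map_smul, hc', smul_comm]

/-- **The unramified half of Flath's theorem without the restricted tensor product**: if the irreducible local type `τ` is
`K`-spherical in the weak sense `dim T^K ≤ 1` and `π` is `τ`-isotypic, then every `[KgK]` (`KgK/K` finite) acts on
`W^K` by the scalar through which it acts on `T^K`. [cite: FlathCorvallis1979, Thm. 2] -/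
theorem exists_heckeOperator_apply_eq_smul_of_isotypic [τ.IsIrreducible]
    (hπ : isotypicComponent k[G] π.asModule τ.asModule = ⊤) (g : G) (hfin : (orbit K (g : G ⧸ K)).Finite)
    [FiniteDimensional k (τ.fixedPoints K)] (h1 : Module.finrank k (τ.fixedPoints K) ≤ 1) :
    ∃ c : k, (∀ t ∈ τ.fixedPoints K, heckeOperator τ K g t = c • t) ∧
      ∀ w ∈ π.fixedPoints K, heckeOperator π K g w = c • w := by
  obtain ⟨c, hc⟩ := exists_heckeOperator_apply_eq_smul_of_finrank_le_one K τ g hfin h1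
  exact ⟨c, hc, fun w hw => heckeOperator_apply_eq_smul_of_isotypic K τ π hπ g hfin c hc w hw⟩

end Literature.NumberTheory.Automorphic

end
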